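import Summits.Ventures.DiscreteObjects.PP12.FanoFiveKernelSearchSound
import Summits.Ventures.DiscreteObjects.PP12.FanoFiveKernelCover
import Summits.Ventures.DiscreteObjects.PP12.FanoFiveKernelCoverCheck
import Summits.Ventures.DiscreteObjects.PP12.FanoFiveKernelRunsA
import Summits.Ventures.DiscreteObjects.PP12.FanoFiveKernelRunsB
import Summits.Ventures.DiscreteObjects.PP12.FanoFiveKernelRunsC
import Summits.Ventures.DiscreteObjects.PP12.FanoFiveKernelRunsD
import Summits.Ventures.DiscreteObjects.PP12.FanoFiveKernelRunsE
import Summits.Ventures.DiscreteObjects.PP12.FanoFiveKernelRunsF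
import Summits.Ventures.DiscreteObjects.PP12.FanoFiveKernelRunsG
import Summits.Ventures.DiscreteObjects.PP12.FanoFiveKernelRunsH

/-!
# PP(12), ORDER 5 IN THE KERNEL: `NoWordCode`, hence a projective plane of order 12 has no collineation of order 5 (kernel theorem)
Framing: lottery ticket; floor = certified bounds/negative ranges.

Cell pub-namedobj (venture DiscreteObjects), target (M), designs gen 18 (designs g17 HANDOFF item (c)). Assembly of the kernel certificate for the order-5
cell of PP(12): the covering table is valid (`FanoFiveKernelCoverCheck.coverCheck_eq_true`, one `decide +kernel`); so every feasible weight-2 quadruple is moved into one of the 17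
representatives `Kernel.reps` by a generator word of `S₅ × S₂` (`cover_of_feasible`); a word code `W` (`FanoFiveECodeWords.IsWordCode`) has a feasible
weight-2 part (`FanoFiveKernelCover.feasible_of_isWordCode`), its image under the generator word is again a word code (`isWordCode_applyGens`) whose
weight-2 part is (a permutation of) the representative and whose parts pass `Cert.FullP` (`parts_of_isWordCode`) — contradicting the kernel run on that
representative (`FanoFiveKernelRunsA–H`) by `Kernel.search_refutes` (`FanoFiveKernelSearchSound`). Hence **`FanoFive.Kernel.noWordCode : NoWordCode`** and,
by designs g17's chain `noOrderFive_of_noWordCode` (`FanoFiveECodeWords` ← `FanoFiveECodeNormal` ← `FanoFiveECode` ← `FanoFiveSignReduction` ← …),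
**`noOrderFiveOrder12_holds : NoOrderFiveOrder12`** — every projective plane of order 12 (as `ProjectivePlane P L` with `order = 12`) has no collineation of
order 5. In print this cell is EXCLUDED by computer (Janko–van Trung 1982); here it is a theorem of the Lean kernel (6,221 search nodes over 17 orbit
representatives + one covering check), the first computer cell of the PP(12) collineation census fully inside the kernel. Outside the kernel the same statement
was decided EMPTY by four engines (designs g10 codeB, designs g17 ecode2, verify-ref engine 3, designs g18 wc3). No `sorry`, no new axioms.
-/

namespace Summit.Ventures.DiscreteObjects.PP12

open Finset

namespace FanoFive

namespace Kernel

open Cert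

/-- reading a `zipWith`-check without evaluating the lists: every element of the left list has a partner row that passes -/
theorem exists_of_zipWith_all {α β : Type} (p : α → β → Bool) :
    ∀ (l : List α) (m : List β), l.length = m.length → (List.zipWith p l m).all id = true → ∀ a ∈ l, ∃ b ∈ m, p a b = true
  | [], _, _, _, a, ha => by simp at ha
  | _ :: _, [], hlen, _, _, _ => by simp at hlen
  | x :: l, y :: m, hlen, hall, a, ha => by
    simp only [List.zipWith_cons_cons, List.all_cons, Bool.and_eq_true, id] at hall
    rcases List.mem_cons.1 ha with rfl | ha'
    · exact ⟨y, List.mem_cons_self, hall.1⟩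
    · obtain ⟨b, hb, hpb⟩ := exists_of_zipWith_all p l m (by simpa using hlen) hall.2 a ha'
      exact ⟨b, List.mem_cons_of_mem y hb, hpb⟩

/-- reading the covering check: every feasible quadruple is moved INTO a representative by a word in the five generators -/
theorem cover_of_feasible {A : List ℕ} (hA : A.Sublist W2) (hlen : A.length = 4) (hf : feasible A = true) :
    ∃ gs : List ℕ, (∀ g ∈ gs, g < 5) ∧ ∃ R ∈ reps, ∀ a ∈ A, applyGens gs a ∈ R := by
  have hmem : A ∈ feasKeys := by
    unfold feasKeys
    rw [List.mem_filter]
    exact ⟨List.mem_sublistsLen.2 ⟨hA, hlen⟩, hf⟩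
  have hc := coverCheck_eq_true
  unfold coverCheck at hc
  rw [Bool.and_eq_true, beq_iff_eq] at hc
  obtain ⟨hlenT, hrows⟩ := hc
  obtain ⟨e, -, hrow⟩ := exists_of_zipWith_all coverRow feasKeys coverTab hlenT hrows A hmem
  unfold coverRow at hrow
  simp only [Bool.and_eq_true, List.all_eq_true, List.any_eq_true, decide_eq_true_eq] at hrow
  obtain ⟨⟨-, hg⟩, R, hR, hin⟩ := hrow
  exact ⟨e.2, fun g hg' => hg g hg', R, hR, fun a ha => hin _ (List.mem_map.2 ⟨a, ha, rfl⟩)⟩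

/-- facts about the representatives: no duplicates, four weight-2 words each -/
theorem reps_facts : ∀ R ∈ reps, R.Nodup ∧ R.length = 4 := by decide

/-- **the certificate, assembled**: if the search refutes every representative then there is no word code -/
theorem noWordCode_of_runs (hruns : ∀ R ∈ reps, search 45 ([0, 95, 63] ++ R) W4 9 = true) : NoWordCode := by
  intro W hW
  obtain ⟨n2, -, -, hlt2, hW2, -⟩ := lists_facts2
  set A : List ℕ := W2.filter fun w => decide (w ∈ W) with hAdef
  have hAmem : ∀ w, w ∈ A ↔ w ∈ W2 ∧ w ∈ W := fun w => by simp [hAdef]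
  obtain ⟨hAlen, -, -⟩ := parts_of_isWordCode hW
  obtain ⟨gs, hgs, R, hR, hAR⟩ := cover_of_feasible List.filter_sublist hAlen (feasible_of_isWordCode hW)
  obtain ⟨hRnd, hRlen⟩ := reps_facts R hR
  -- the moved code and its parts
  have hW' : IsWordCode (W.image (applyGens gs)) := isWordCode_applyGens hgs hW
  obtain ⟨hA'len, hC'len, hFull⟩ := parts_of_isWordCode hW'
  set A' : List ℕ := W2.filter fun w => decide (w ∈ W.image (applyGens gs)) with hA'def
  set C' : List ℕ := W4.filter fun w => decide (w ∈ W.image (applyGens gs)) with hC'def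
  have hA'mem : ∀ w, w ∈ A' ↔ w ∈ W2 ∧ w ∈ W.image (applyGens gs) := fun w => by simp [hA'def]
  -- the weight-2 part of the moved code lies in the representative …
  have hsub1 : ∀ w, w ∈ A' → w ∈ R := by
    intro w hw
    obtain ⟨hw2, hwW'⟩ := (hA'mem w).1 hw
    rw [Finset.mem_image] at hwW'
    obtain ⟨v, hv, rfl⟩ := hwW'
    have hv128 : v < 128 := hW.lt v hv
    obtain ⟨hwt, -⟩ := applyGens_weight hgs hv128
    have h2 : hdist 0 (applyGens gs v) = 2 := (hW2 _ (hlt2 _ hw2)).1 hw2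
    rw [hwt] at h2
    exact hAR v ((hAmem v).2 ⟨(hW2 v hv128).2 h2, hv⟩)
  -- … hence is a permutation of it
  have hperm : A'.Perm R := by
    have hA'nd : A'.Nodup := n2.filter _
    have hsub : A'.toFinset ⊆ R.toFinset := fun w hw => List.mem_toFinset.2 (hsub1 w (List.mem_toFinset.1 hw))
    have hcard : R.toFinset.card ≤ A'.toFinset.card := by
      rw [List.toFinset_card_of_nodup hRnd, List.toFinset_card_of_nodup hA'nd, hRlen, hA'len]
    have heq := Finset.eq_of_subset_of_card_le hsub hcard
    exact (List.perm_ext_iff_of_nodup hA'nd hRnd).2 fun w => by rw [← List.mem_toFinset, heq, List.mem_toFinset]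
  -- transport the leaf test to the representative's list and contradict the kernel run
  have hFull2 : FullP (([0, 95, 63] ++ R) ++ C') := fullP_perm ((hperm.append_left [0, 95, 63]).append_right C') hFull
  exact search_refutes (hruns R hR) C' List.filter_sublist hC'len hFull2

/-- the seventeen kernel runs, dispatched over `reps` -/
theorem runs : ∀ R ∈ reps, search 45 ([0, 95, 63] ++ R) W4 9 = true := by
  intro R hR
  simp only [reps, List.mem_cons, List.not_mem_nil, or_false] at hR
  rcases hR with rfl | rfl | rfl | rfl | rfl | rfl | rfl | rfl | rfl | rfl | rfl | rfl | rfl | rfl | rfl | rfl | rfl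
  exacts [run_3_5_6_96, run_3_5_9_96, run_6_9_10_96, run_12_17_18_96, run_3_5_33_65, run_3_5_33_66, run_3_5_33_72, run_3_5_34_66,
    run_5_6_34_65, run_3_5_40_68, run_3_5_48_80, run_12_24_33_66, run_3_12_36_68, run_3_12_33_66, run_5_24_40_65, run_3_12_48_68, run_3_12_48_80]

/-- **THE CODING STATEMENT OF THE ORDER-5 CELL, DECIDED IN THE KERNEL: there is no word code.** -/
theorem noWordCode : NoWordCode := noWordCode_of_runs runs

end Kernel

end FanoFive

/-- **THE ORDER-5 CELL OF PP(12) AS A KERNEL THEOREM: a projective plane of order 12 admits no collineation of order 5**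
(in print: Janko–van Trung 1982, by computer; here: designs g15–g17's kernel reductions + the kernel certificate above). -/
theorem noOrderFiveOrder12_holds : NoOrderFiveOrder12 := noOrderFive_of_noWordCode FanoFive.Kernel.noWordCode

end Summit.Ventures.DiscreteObjects.PP12
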